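import Mathlib
import HarnessLib
import Summits.HubbardSuperconductivity.HubbardSuperconductivity.Theorems.KLProgrammeKLRegimeEngineV8DefsU7

/-!
# K3 ENGINE package v9 — token #10 FINAL (plan g17 (R41d)): `klEngU₀9 P R c := min (klEngU₀8 P R c) (R.cz * klEngU₀4 P R c)`
# (the (E3-THR) door with T2-2's polynomial-killer body) and its exported budget hook

Cell `gate-hubbard-kl`, seat p1b (g8), token-#10 author.  (R41d): the history-route (E3d)/(E3e) increments are `P`-free at `O(U²)` and covered by
`…DefsU7` §4's allowance `klE3Acum = 2^40·klE3A1` inside `klEngU₀8`; a tower-route majorant built on the public sizes `CE²·ε_m·2^m` is `K(P,R,c)·U²` with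
`K` polynomial in `klEngPsq P`, `klEngRsq R` of degree unknown today — the engine's zero-cost device for exactly this is the polynomial-killer threshold
`klEngU₀4 P R c = 2^{−128}/(klEngPsq P⁴·klEngRsq R⁴·(c²+1))`, so the registered door is
* **`klEngU₀9 P R c := min (klEngU₀8 P R c) (R.cz * klEngU₀4 P R c)`**, `klEngU₀9_pos (P) {R} (h : 0 < R.cz) (c)` (+ `_pos_of_WF2`),
  `klEngU₀9_le_klEngU₀8 / _le_klEngU₀7 / _le_klEngU₀6 / _le_klEngU₀4 / _le_klEngU₀3 / _le_klE3U₀`, `klEngU₀9_le_cz_mul_klEngU₀4`;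
* the EXPORTED HOOK every (e)/(M) closer cites: **`sq_budget_of_le_klEngU₀9`** — `0 ≤ K → 0 < U → U ≤ klEngU₀9 P R c → K·U² ≤ R.cz·|U|·(K·klEngU₀4 P R c)`
  (so any increment majorant `K·U²` with `K·klEngU₀4 P R c` inside the (E3e)/(E3d) budget share sits next to the scale-`0` piece);
* `bareFrame_numerals_of_le_klEngU₀9` — the four scale-`0` numerals of the (M) closers (…DefsU7 §3) under the registered threshold, by one `.trans`.
Definitions (one closed real term) + signs + one-line algebra; nothing about the model is asserted; nothing asserts superconductivity.
-/

noncomputable section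

namespace Summit.HubbardSuperconductivity.HubbardSuperconductivity.Theorems.EngineV8

set_option linter.dupNamespace false -- summit = problem name (single-conjunct summit), D-0017

open Real Finset Literature.MathematicalPhysics.QuantumLattice Literature.Probability.LatticeModels
open Literature.MathematicalPhysics.QuantumLattice.BandSectorCounting
open Summit.HubbardSuperconductivity.HubbardSuperconductivity.Theorems.KLRegimeSplit

/-- **`klEngU₀9 P R c := min (klEngU₀8 P R c) (R.cz * klEngU₀4 P R c)`** — token #10 of the 20437 registration ((R41d)): the all-scales two-leg door
(`klEngU₀8`, …DefsU7 §4) capped by the `cz`-scaled polynomial-killer threshold. -/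
def klEngU₀9 (P : SplitConsts) (R : RenConsts) (c : ℝ) : ℝ := min (klEngU₀8 P R c) (R.cz * klEngU₀4 P R c)

/-- `0 < klEngU₀9 P R c` whenever `0 < R.cz`. -/
theorem klEngU₀9_pos (P : SplitConsts) {R : RenConsts} (h : 0 < R.cz) (c : ℝ) : 0 < klEngU₀9 P R c :=
  lt_min (klEngU₀8_pos P h c) (mul_pos h (klEngU₀4_pos P R c))

/-- `0 < klEngU₀9 P R c` under `R.WF2` (`hR.2.2 : 0 < R.cz`). -/
theorem klEngU₀9_pos_of_WF2 (P : SplitConsts) {R : RenConsts} (hR : R.WF2) (c : ℝ) : 0 < klEngU₀9 P R c := klEngU₀9_pos P hR.2.2 c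

/-- `klEngU₀9 ≤ klEngU₀8`. -/
theorem klEngU₀9_le_klEngU₀8 (P : SplitConsts) (R : RenConsts) (c : ℝ) : klEngU₀9 P R c ≤ klEngU₀8 P R c := min_le_left _ _

/-- `klEngU₀9 ≤ R.cz · klEngU₀4`. -/
theorem klEngU₀9_le_cz_mul_klEngU₀4 (P : SplitConsts) (R : RenConsts) (c : ℝ) : klEngU₀9 P R c ≤ R.cz * klEngU₀4 P R c := min_le_right _ _

/-- `klEngU₀9 ≤ klEngU₀7` (`0 < R.cz`). -/
theorem klEngU₀9_le_klEngU₀7 (P : SplitConsts) {R : RenConsts} (h : 0 < R.cz) (c : ℝ) : klEngU₀9 P R c ≤ klEngU₀7 P R c :=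
  (klEngU₀9_le_klEngU₀8 P R c).trans (klEngU₀8_le_klEngU₀7 P h c)

/-- `klEngU₀9 ≤ klE3U₀` (`0 < R.cz`; so the scale-`0` numerals of …DefsU7 §3 apply). -/
theorem klEngU₀9_le_klE3U₀ (P : SplitConsts) {R : RenConsts} (h : 0 < R.cz) (c : ℝ) : klEngU₀9 P R c ≤ klE3U₀ R :=
  (klEngU₀9_le_klEngU₀8 P R c).trans (klEngU₀8_le_klE3U₀ P h c)

/-- `klEngU₀9 ≤ klE3U₀all` (the all-scales allowance door of …DefsU7 §4). -/
theorem klEngU₀9_le_klE3U₀all (P : SplitConsts) (R : RenConsts) (c : ℝ) : klEngU₀9 P R c ≤ klE3U₀all R :=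
  (klEngU₀9_le_klEngU₀8 P R c).trans (klEngU₀8_le_klE3U₀all P R c)

/-- `klEngU₀9 ≤ klEngU₀6`. -/
theorem klEngU₀9_le_klEngU₀6 (P : SplitConsts) (R : RenConsts) (c : ℝ) : klEngU₀9 P R c ≤ klEngU₀6 P R c :=
  (klEngU₀9_le_klEngU₀8 P R c).trans (klEngU₀8_le_klEngU₀6 P R c)

/-- `klEngU₀9 ≤ klEngU₀4`. -/
theorem klEngU₀9_le_klEngU₀4 (P : SplitConsts) (R : RenConsts) (c : ℝ) : klEngU₀9 P R c ≤ klEngU₀4 P R c :=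
  (klEngU₀9_le_klEngU₀8 P R c).trans (klEngU₀8_le_klEngU₀4 P R c)

/-- `klEngU₀9 ≤ klEngU₀3`. -/
theorem klEngU₀9_le_klEngU₀3 (P : SplitConsts) (R : RenConsts) (c : ℝ) : klEngU₀9 P R c ≤ klEngU₀3 P R c :=
  (klEngU₀9_le_klEngU₀8 P R c).trans (klEngU₀8_le_klEngU₀3 P R c)

/-- **THE EXPORTED BUDGET HOOK** ((R41d)): for `0 ≤ K`, `0 < U ≤ klEngU₀9 P R c`: `K·U² ≤ R.cz·|U|·(K·klEngU₀4 P R c)` — an increment majorant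
`K(P,R,c)·U²` whose `K·klEngU₀4 P R c` fits the budget share sits inside `R.cz·|U|·(share)`. -/
theorem sq_budget_of_le_klEngU₀9 {P : SplitConsts} {R : RenConsts} {c U K : ℝ} (hK : 0 ≤ K) (hU : 0 < U) (hUle : U ≤ klEngU₀9 P R c) :
    K * U ^ 2 ≤ R.cz * |U| * (K * klEngU₀4 P R c) := by
  have h := hUle.trans (klEngU₀9_le_cz_mul_klEngU₀4 P R c)
  rw [abs_of_pos hU]
  calc K * U ^ 2 = (K * U) * U := by ring
    _ ≤ (K * U) * (R.cz * klEngU₀4 P R c) := mul_le_mul_of_nonneg_left h (mul_nonneg hK hU.le)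
    _ = R.cz * U * (K * klEngU₀4 P R c) := by ring

/-- **The four scale-`0` numerals of the bare-frame two-leg closers under the registered threshold** (`0 < R.cz`, `0 < U ≤ klEngU₀9 P R c`). -/
theorem bareFrame_numerals_of_le_klEngU₀9 (P : SplitConsts) {R : RenConsts} (hcz : 0 < R.cz) {c U : ℝ} (hU : 0 < U)
    (hU9 : U ≤ klEngU₀9 P R c) :
    16 * Real.exp 1 ^ 9 * Real.sqrt (2 * (7 + 1606732)) ^ 2 * klScaleZeroA0 * |U| ≤ 1 / 4 ∧
    16 * Real.exp 1 ^ 9 * Real.sqrt (2 * (7 + 1606732)) ^ 2 * klE3A1 R * |U| ≤ 1 / 2 ∧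
    (2 : ℝ) ^ 10 * Real.exp 1 ^ 18 * Real.sqrt (2 * (7 + 1606732)) ^ 4 * klE3A1 R * U ^ 2 ≤ R.cz * |U| ∧
    (2 : ℝ) ^ 11 * Real.exp 1 ^ 18 * Real.sqrt (2 * (7 + 1606732)) ^ 4 * klE3A1 R * U ^ 2 + 4 / 3 * R.Gfr 1 * U ^ 2 ≤
      R.cz * |U| * (cDtmin (-1.2) (-0.05) / 2) :=
  bareFrame_numerals_of_le_klE3U₀ hcz hU (hU9.trans (klEngU₀9_le_klE3U₀ P hcz c))

end Summit.HubbardSuperconductivity.HubbardSuperconductivity.Theorems.EngineV8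

end
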